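import Literature.Probability.Percolation.ArmSeparationOutEvents
import Literature.Probability.Percolation.LocallyMonotoneFKG
import HarnessLib

/-!
# The outer landing step: disjoint supports, and tiny-fenced outer tips land on `∂Λ_{4M}`

Topic: Probability / Percolation; family `crit-perc` (`P = P_{1/2} = triSitePercolation half`). A
brick of the discharge of `Literature.Probability.Percolation.Nolin2008_twoArm_separation`
(Nolin 2008, Thm. 11 [arXiv 0711.4948: Thm. 10], `j = 2`, `σ = BW`; `ArmSeparation.lean`): the
landing inequality `g K ≤ C₁ · h (K+1)` of the multi-scale scheme (`ArmSeparationScheme.lean`) for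
the EXTERNAL extremities (Nolin 2008, §4.4, p. 12, with Prop. 12 (iii)–(i) [arXiv Prop. 11] and
Lemma 13 [arXiv Lemma 12]:
`P(Ã^{·/η'}(2^k,2^{K-i'})) ≤ C₁(η') P(Ã̃^{·/η',I_{η'}}(2^k,2^{K-i'})) ≤ C₁(η') C₂(η') P(Ã̃^{·/η'₀,I_{η'₀}}(2^k,2^{K-i'+1}))`).

**Disjointness** (the outward twin of `ArmSeparationSlotSep.lean` / `ArmSeparationSlotDisjoint.lean`;
Lemma 13 needs the supports `𝒜`, `𝒜⁺`, `𝒜⁻` pairwise disjoint): for a valid outer rung and a slot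
in range, admissible and separated, the private supports `oPfin σ`, `oMfin σ`
(`ArmSeparationOutEvents.lean`) are disjoint from each other (`Slot.disjoint_oPfin_oMfin`, nine
pairs of pieces) and from the shared support `osharedFin n M` (`Slot.disjoint_oshared`: every
private site lies beyond `Λ_{2M}`). The nine pairs are separated by norm bands (rings at depths
`≈ μ` and `≈ 3μ` beyond `∂Λ_{2M}`, tip structures at depth `≤ 2k + L`, targets at `∂Λ_{4M}`), by
sectors (`disjoint_sectorNear`), by the row gap on a common side (`OSepOK`), by the choice of the
target rows (danger zones, `oξc_far`) and by the windows cut out of the two rings.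

**Landing**: for a valid outer rung `P` (`OParams.Valid`), the event `OutMidPair P` — a fenced open
outer arm in some frame `io < 6` and a fenced closed outer arm in some frame `ic < 6`
(`TrapFencedArm`, tips on side `0` of `∂Λ_{2M}` of the frame, middle tips) — satisfies
`P(OutMidPair P) ≤ C₁ · P(extTwoArm n (4M))`, where `C₁ = 36 K² Nw² / (c_F c^(12 nW + 3))²` only
depends on the number of slots and on the RSW constants (hence on the ratio `M / k₀`, which the
scheme keeps bounded).

* `Slot.disjoint_oPfin_oMfin`, `Slot.disjoint_oshared` — disjoint supports;
* `Slot.omove` — for each slot, `oblackArm ∩ owhiteArm ∩ (oblackCorr ∩ owhiteCorr) ⊆ extTwoArm n (4M)`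
  (`out_landing_move`, `out_white_landing_move`, with the routing facts of `ArmSeparationOutArith.lean`);
* `Slot.real_oarms_le` — Nolin's Lemma 13 per slot:
  `P(oblackArm ∩ owhiteArm) · (c_F c^(12 nW+3))² ≤ P(extTwoArm n (4M))`;
* `OutMidPair`, `otupleFin`, `slotOf`, `outMidPair_subset_biUnion`, `real_outMidPair_le` — the sum over slots.

## References

* P. Nolin, *Near-critical percolation in two dimensions*, Electron. J. Probab. 13 (2008), §4.3
  Prop. 12, Lemma 13, §4.4 (proof of Thm. 11, external extremities) [arXiv 0711.4948: Prop. 11,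
  Lemma 12, Thm. 10, p. 12]. [Nolin2008]
* H. Kesten, *Scaling relations for 2D-percolation*, Comm. Math. Phys. 109 (1987), Lemma 2, §2. [Kesten1987]
-/

noncomputable section

open Set MeasureTheory

namespace Literature.Probability.Percolation

open LatticeModels Tube

/-! ### The pieces of a support -/

/-- **The near set of an outer tip**: `frameIso i` of the outer slot frame box and of the outer spoke's box. [folklore] -/
def onearSet (i M k : ℕ) (T₀ : ℤ) (w L ε : ℕ) : Set (Site 2) :=
  frameIso i '' ((↑(oslotFrame M k T₀ w) : Set (Site 2)) ∪ (ospokeTube M k T₀ w L ε).box)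

/-- **The far set of an outer corridor**: the approach box and the target box. [folklore] -/
def ofarSet (r e : ℕ) (t : ℤ) (W N' : ℕ) : Set (Site 2) :=
  triStrip ((r : ℤ) - 2 * e) t W (N' / 64) ∪ triStrip ((N' : ℤ) + 1) (t - (N' / 64 : ℕ)) (N' / 16 - 1) (2 * (N' / 64))

/-- The support of an outer corridor, as a set. [folklore] -/
theorem coe_ocorrFin (i M k : ℕ) (T₀ : ℤ) (w L ε r e s a len : ℕ) (t : ℤ) (W N' : ℕ) :
    (↑(ocorrFin i M k T₀ w L ε r e s a len t W N') : Set (Site 2)) =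
      onearSet i M k T₀ w L ε ∪ boxAll (arc (thinRing r e s) a len) ∪ ofarSet r e t W N' := by
  unfold ocorrFin onearSet ofarSet
  rw [Finset.coe_union, Finset.coe_union, Finset.coe_union, Finset.coe_image, Finset.coe_union, coe_sites, coe_sitesAll,
    coe_triStripFinset, coe_triStripFinset, Set.union_assoc]

/-- **Where the near set is** (frame coordinates): a point of `onearSet i M k T₀ w L ε` is
`frameIso i u` with `2M + 1 ≤ u₀ ≤ 2M + 2k - 1 + L` and `T₀ + 1 ≤ u₁ ≤ T₀ + w + 4k`
(`2 ≤ k`, `ε ≤ k`, `3k + 1 ≤ L`). [folklore] -/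
theorem exists_of_mem_onearSet {i M k : ℕ} {T₀ : ℤ} {w L ε : ℕ} (hk : 2 ≤ k) (hε : ε ≤ k) (hL : 3 * k + 1 ≤ L)
    {v : Site 2} (hv : v ∈ onearSet i M k T₀ w L ε) :
    ∃ u : Site 2, v = frameIso i u ∧ 2 * (M : ℤ) + 1 ≤ u 0 ∧ u 0 ≤ 2 * (M : ℤ) + 2 * k - 1 + L ∧ T₀ + 1 ≤ u 1 ∧ u 1 ≤ T₀ + w + 4 * k := by
  obtain ⟨u, hu, rfl⟩ := hv
  refine ⟨u, rfl, ?_⟩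
  rcases hu with hu | hu
  · rw [Finset.mem_coe, mem_oslotFrame (by omega)] at hu; omega
  · obtain ⟨h1, h2, h3, h4⟩ := bounds_of_mem_ospokeBox hu
    have : 4 * ((k / 4 : ℕ) : ℤ) ≤ k := by omega
    have hε' : (ε : ℤ) ≤ k := by exact_mod_cast hε
    omega

/-- Points of the spoke part of the near set, in frame coordinates. [folklore] -/
theorem exists_of_mem_image_ospokeBox {i M k : ℕ} {T₀ : ℤ} {w L ε : ℕ} {v : Site 2}
    (hv : v ∈ frameIso i '' (ospokeTube M k T₀ w L ε).box) :
    ∃ u : Site 2, v = frameIso i u ∧ 2 * (M : ℤ) + 2 * k - 1 - (k / 4 : ℕ) ≤ u 0 ∧ u 0 ≤ 2 * (M : ℤ) + 2 * k - 1 + L ∧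
      T₀ + 2 * k + w - ε ≤ u 1 ∧ u 1 ≤ T₀ + 2 * k + w + ε := by
  obtain ⟨u, hu, rfl⟩ := hv
  exact ⟨u, rfl, bounds_of_mem_ospokeBox hu⟩

/-- **The near set lies just beyond `Λ_{2M}`**: `2M < |v| ≤ 2M + 2k + L` (`i < 6`, `2 ≤ k`, `ε ≤ k`,
`3k + 1 ≤ L`, tip window with `-2M ≤ T₀` and `T₀ + w + 4k ≤ 0`). [folklore] -/
theorem norm_of_mem_onearSet {i M k : ℕ} {T₀ : ℤ} {w L ε : ℕ} (hi : i < 6) (hk : 2 ≤ k) (hε : ε ≤ k) (hL : 3 * k + 1 ≤ L)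
    (hT1 : -(2 * (M : ℤ)) ≤ T₀) (hT2 : T₀ + w + 4 * k ≤ 0) {v : Site 2} (hv : v ∈ onearSet i M k T₀ w L ε) :
    2 * (M : ℤ) < triNorm v ∧ triNorm v ≤ 2 * (M : ℤ) + 2 * k + L := by
  obtain ⟨u, rfl, h1, h2, h3, h4⟩ := exists_of_mem_onearSet hk hε hL hv
  rw [triNorm_frameIso i hi]
  exact ⟨lt_triNorm_iff_lin.2 (Or.inl (by omega)), triNorm_le_iff_lin.2 (by omega)⟩

/-- **The arc lies in the band of its ring**: `r - s - 2e ≤ |v| ≤ r + 2e` (`2e ≤ r`). [folklore] -/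
theorem norm_of_mem_boxAll_arc {r e s a len : ℕ} (he : 2 * e ≤ r) {v : Site 2} (hv : v ∈ boxAll (arc (thinRing r e s) a len)) :
    (r : ℤ) - s - 2 * e ≤ triNorm v ∧ triNorm v ≤ (r : ℤ) + 2 * e := by
  obtain ⟨T, hT, hvT⟩ := hv
  exact triNorm_mem_of_mem_thinRing he (mem_of_mem_arc hT) hvT

/-- **The far set lies beyond the ring**: `r - 2e ≤ v₀` (so `r - 2e ≤ |v|`) for its points
(`r ≤ N' + 2e + 1`). [folklore] -/
theorem apply_zero_of_mem_ofarSet {r e : ℕ} {t : ℤ} {W N' : ℕ} (hr : (r : ℤ) ≤ N' + 2 * e + 1) {v : Site 2} (hv : v ∈ ofarSet r e t W N') :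
    (r : ℤ) - 2 * e ≤ v 0 := by
  rcases hv with hv | hv <;> rw [mem_triStrip] at hv <;> omega

/-! ### Index comparisons -/

/-- If the position `ξ` has lateral index `≥ ι` and lies at most `d < s` beyond the chunk of index
`κ`, then `ι ≤ κ + 1`. [folklore] -/
theorem idx_le_succ_of_le_add {s ι κ : ℕ} {r ξ d : ℤ} (hds : d < s) (h1 : -r + (ι : ℤ) * s ≤ ξ)
    (h2 : ξ ≤ -r + ((κ : ℤ) + 1) * s + d) : ι ≤ κ + 1 := by
  by_contra h'
  push Not at h'
  have : (κ : ℤ) + 2 ≤ ι := by exact_mod_cast h'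
  have hs : (0 : ℤ) ≤ s := by positivity
  nlinarith

/-- If the chunk of index `κ` starts at most `d < s` beyond the position `ξ`, of lateral index `≤ ι`,
then `κ ≤ ι + 1`. [folklore] -/
theorem idx_le_succ_of_lt {s ι κ : ℕ} {r ξ d : ℤ} (hds : d < s) (h1 : -r + (κ : ℤ) * s ≤ ξ + d)
    (h2 : ξ < -r + ((ι : ℤ) + 1) * s) : κ ≤ ι + 1 := by
  by_contra h'
  push Not at h'
  have : (ι : ℤ) + 2 ≤ κ := by exact_mod_cast h'
  have hs : (0 : ℤ) ≤ s := by positivity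
  nlinarith

/-! ### The pieces, pairwise -/

/-- **Near sets of the two colours are disjoint**: on a common side by the row gap (`OSepOK`), on
different sides by sectors (the near set of a middle tip of the side `i` lies in the `i`-th sector
with margin `R₀ - (4k + w)`). [folklore] -/
theorem onearSet_disjoint_onearSet {io ic M : ℕ} (hio : io < 6) (hic : ic < 6) {ko kc : ℕ} {To Tc : ℤ} {w LB LW ε R₀ : ℕ}
    (hko : 2 ≤ ko) (hkc : 2 ≤ kc) (hεo : ε ≤ ko) (hεc : ε ≤ kc) (hLo : 3 * ko + 1 ≤ LB) (hLc : 3 * kc + 1 ≤ LW)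
    (hadm : To ≤ -(R₀ : ℤ) ∧ -(2 * (M : ℤ)) + R₀ < To + w ∧ Tc ≤ -(R₀ : ℤ) ∧ -(2 * (M : ℤ)) + R₀ < Tc + w)
    (hlam : 4 * (ko : ℤ) + 4 * kc + 2 * w < R₀) (hwk : 2 * (w : ℤ) ≤ 4 * ko ∧ 2 * (w : ℤ) ≤ 4 * kc)
    (hsep : io ≠ ic ∨ To + 8 * ko < Tc + w ∨ Tc + 8 * kc < To + w)
    {v : Site 2} (hvo : v ∈ onearSet io M ko To w LB ε) (hvc : v ∈ onearSet ic M kc Tc w LW ε) : False := by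
  obtain ⟨uo, rfl, ho0, ho0', ho1, ho1'⟩ := exists_of_mem_onearSet hko hεo hLo hvo
  obtain ⟨uc, huc, hc0, hc0', hc1, hc1'⟩ := exists_of_mem_onearSet hkc hεc hLc hvc
  by_cases hii : io = ic
  · subst hii
    have : uo = uc := (frameIso io).injective huc
    subst this
    rcases hsep with h | h | h
    · exact h rfl
    · omega
    · omega
  · have hso : frameIso io uo ∈ sectorNear io ((R₀ : ℤ) - (4 * ko + w)) :=
      (frameIso_mem_sectorNear_iff hio).2 ⟨by omega, by omega⟩
    have hsc : frameIso ic uc ∈ sectorNear ic ((R₀ : ℤ) - (4 * kc + w)) :=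
      (frameIso_mem_sectorNear_iff hic).2 ⟨by omega, by omega⟩
    rw [← huc] at hsc
    exact Set.disjoint_left.1 (disjoint_sectorNear hio hic hii (by omega)) hso hsc

/-- **Ring tubes outside the spoke's window avoid the outer spoke.** A point of a ring tube
`ringTube r e s g` (`g` outside the six positions of the pieces of lateral index `ιc - 1, ιc, ιc + 1`
of the side `ic` and their connectors) is not a point of the outer spoke of a tip of the frame `ic`
with lateral position `ξ = Tc + 2kc + w`, `-r + ιc s ≤ ξ < -r + (ιc + 1) s`, provided the spoke keeps a
sector margin `lam > 2e` and `e + ε < s`. [folklore] -/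
theorem oringTube_disjoint_ospoke {r e s g ic M kc : ℕ} {Tc : ℤ} {w LW ε ιc : ℕ} (hr : 1 ≤ r / s) (hsr : s ∣ r) (he : 2 * e ≤ r)
    (hg : g < 12 * (r / s) - 4) (hic : ic < 6) (hι1 : 1 ≤ ιc) (hι2 : ιc + 2 ≤ r / s)
    (hout : g < blockOff (r / s) ic + (if ic % 3 = 2 then 2 * (r / s - 2 - ιc) else 2 * (ιc - 1)) ∨
      blockOff (r / s) ic + (if ic % 3 = 2 then 2 * (r / s - 2 - ιc) else 2 * (ιc - 1)) + 5 < g)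
    (hξ : -(r : ℤ) + ιc * s ≤ Tc + 2 * kc + w ∧ Tc + 2 * kc + w < -(r : ℤ) + (ιc + 1) * s) (hes : (e : ℤ) + ε < s)
    {lam : ℤ} (hlam : 2 * (e : ℤ) < lam) (hlam1 : Tc + 2 * kc + w + ε ≤ -lam)
    (hlam2 : lam ≤ 2 * (M : ℤ) + 2 * kc - 1 - (kc / 4 : ℕ) + (Tc + 2 * kc + w) - ε)
    {v : Site 2} (hv : v ∈ (ringTube r e s g).box) (hv' : v ∈ frameIso ic '' (ospokeTube M kc Tc w LW ε).box) : False := by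
  obtain ⟨u, rfl, hu0, hu0', hu1, hu1'⟩ := exists_of_mem_image_ospokeBox hv'
  obtain ⟨hsec, hl1, hl2, -, -⟩ := ringTube_bounds hr hsr he hg hv
  have hsc : frameIso ic u ∈ sectorNear ic lam := (frameIso_mem_sectorNear_iff hic).2 ⟨by omega, by omega⟩
  by_cases hside : ringSide r s g = ic
  · rw [hside, lat_frameIso hic] at hl1 hl2
    -- the lateral index of the tube is within one of `ιc`
    have hι : ιc - 1 ≤ ringLat r s g ∧ ringLat r s g ≤ ιc + 1 := by
      constructor
      · have := idx_le_succ_of_le_add (d := (e : ℤ) + ε) (ι := ιc) (κ := ringLat r s g) (r := (r : ℤ)) (ξ := Tc + 2 * kc + w)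
          hes hξ.1 (by linarith)
        omega
      · exact idx_le_succ_of_lt (d := (e : ℤ) + ε) hes (by linarith) hξ.2
    have hpos := pos_le_of_side_lat hr hg
    rw [hside] at hpos
    unfold piecePos at hpos
    rcases hout with hout | hout <;> split_ifs at hout hpos <;> omega
  · exact Set.disjoint_left.1 (disjoint_sectorNear (ringSide_lt r s g) hic hside (by omega)) hsec hsc

/-- **The approach tube of the open arm avoids the near set of the closed tip**: on another side by
sectors, on the side `0` by rows (the closed beacon is far from the target rows, `oξc_far`). [folklore] -/
theorem oapproach_disjoint_onearSet {P : OParams} {σ : Slot} (hV : P.Valid) (hσ : σ.OInRange P) (hadm : σ.OAdmissible P)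
    {v : Site 2} (hv : v ∈ triStrip ((P.rB : ℤ) - 2 * P.e) (σ.otgo P) P.WB (P.N' / 64))
    (hv' : v ∈ onearSet σ.ic P.M (σ.okc P) (σ.oTc P) P.w P.LW P.ε) : False := by
  obtain ⟨hs, hk₀, hμ, hw1, hw2, he1, he2, hε1, hε2, hrB1, hrB2, hrW1, hrW2, hnB, hnW, hN, hWB, hWW, hn, hμM, hR₀, hR₀M, hLB, hLW⟩ := hV.ifacts
  have hkc1 : (P.k₀ : ℤ) ≤ σ.okc P := by exact_mod_cast le_trapScale P.k₀ σ.jc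
  have hkc2 : 32 * (σ.okc P : ℤ) ≤ P.μ := by exact_mod_cast P.scale_le hσ.hjc
  obtain ⟨ha1, ha2, ha3, ha4⟩ := hadm
  have htgo := otgtRow_mem P.N' (σ.obo P)
  rw [show otgtRow P.N' (σ.obo P) = σ.otgo P from rfl] at htgo
  have hN4 : 4 * ((P.N' / 4 : ℕ) : ℤ) ≤ P.N' ∧ (P.N' : ℤ) ≤ 4 * (P.N' / 4 : ℕ) + 3 := by omega
  have hN16 : 16 * ((P.N' / 16 : ℕ) : ℤ) ≤ P.N' ∧ (P.N' : ℤ) ≤ 16 * (P.N' / 16 : ℕ) + 15 := by omega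
  have hN2 : 2 * ((P.N' / 2 : ℕ) : ℤ) ≤ P.N' ∧ (P.N' : ℤ) ≤ 2 * (P.N' / 2 : ℕ) + 1 := by omega
  have hN64 : 64 * ((P.N' / 64 : ℕ) : ℤ) ≤ P.N' ∧ (P.N' : ℤ) ≤ 64 * (P.N' / 64 : ℕ) + 63 := by omega
  rw [mem_triStrip] at hv
  obtain ⟨u, hvu, hu0, hu0', hu1, hu1'⟩ := exists_of_mem_onearSet (by omega) (by omega) (by omega) hv'
  by_cases hic0 : σ.ic = 0
  · -- rows
    have hfar := Slot.oξc_far hV hic0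
    rw [hic0] at hvu
    have hv1 : v 1 = u 1 := by rw [hvu]; rfl
    have hξc : σ.oξc P = σ.oTc P + 2 * σ.okc P + P.w := rfl
    rcases hfar with hfar | hfar <;> omega
  · -- sectors
    have hsc : frameIso σ.ic u ∈ sectorNear σ.ic ((P.R₀ : ℤ) - (4 * σ.okc P + P.w)) :=
      (frameIso_mem_sectorNear_iff hσ.hic).2 ⟨by omega, by omega⟩
    have hs0 : v ∈ sectorNear 0 ((P.M : ℤ) / 8) := by
      simp only [sectorNear, Set.mem_setOf_eq]; omega
    rw [← hvu] at hsc
    exact Set.disjoint_left.1 (disjoint_sectorNear (by norm_num) hσ.hic (Ne.symm hic0) (by omega)) hs0 hsc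

/-- **Ring tubes of the closed arm outside the approach window avoid the reflected approach tube
of the open arm.** A point `u` of a tube `ringTube rW e s g` with `g` outside the positions
`[oloW, ohiW]` (the side `3` pieces whose lateral indices cover `[oyLo, oyHi]`) is not the reflection
of a point of the approach tube `[rB - 2e, N' + N'/16] × [tgo, tgo + N'/64]`. [folklore] -/
theorem oringTube_disjoint_neg_oapproach {P : OParams} {σ : Slot} (hV : P.Valid) {g : ℕ} (hg : g < 12 * (P.rW / P.s) - 4)
    (hout : g < σ.oloW P ∨ σ.ohiW P < g) {u : Site 2} (hu : u ∈ (ringTube P.rW P.e P.s g).box)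
    (hu' : -u ∈ triStrip ((P.rB : ℤ) - 2 * P.e) (σ.otgo P) P.WB (P.N' / 64)) : False := by
  obtain ⟨hs, hk₀, hμ, hw1, hw2, he1, he2, hε1, hε2, hrB1, hrB2, hrW1, hrW2, hnB, hnW, hN, hWB, hWW, hn, hμM, hR₀, hR₀M, hLB, hLW⟩ := hV.ifacts
  obtain ⟨hnW1, hlohi, hhiR, hblo, hhiB4, hyLo1, hyHi, hylo, hyhi, hylo2, hyhi2, -⟩ := Slot.owindowW_facts (σ := σ) hV
  have htgo := otgtRow_mem P.N' (σ.obo P)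
  rw [show otgtRow P.N' (σ.obo P) = σ.otgo P from rfl] at htgo
  have hN4 : 4 * ((P.N' / 4 : ℕ) : ℤ) ≤ P.N' ∧ (P.N' : ℤ) ≤ 4 * (P.N' / 4 : ℕ) + 3 := by omega
  have hN16 : 16 * ((P.N' / 16 : ℕ) : ℤ) ≤ P.N' ∧ (P.N' : ℤ) ≤ 16 * (P.N' / 16 : ℕ) + 15 := by omega
  have hN2 : 2 * ((P.N' / 2 : ℕ) : ℤ) ≤ P.N' ∧ (P.N' : ℤ) ≤ 2 * (P.N' / 2 : ℕ) + 1 := by omega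
  have hN64 : 64 * ((P.N' / 64 : ℕ) : ℤ) ≤ P.N' ∧ (P.N' : ℤ) ≤ 64 * (P.N' / 64 : ℕ) + 63 := by omega
  rw [mem_triStrip] at hu'
  simp only [Pi.neg_apply] at hu'
  have hnWdef : P.nW = P.rW / P.s := rfl
  have hr1 : 1 ≤ P.rW / P.s := hnWdef ▸ hnW1
  have hsr : P.s ∣ P.rW := ⟨P.nW, by have := hV.facts.2.2.2.2.2.2.2.2.2.2.2.1; rw [mul_comm]; exact this.symm⟩
  obtain ⟨hsec, hl1, hl2, -, -⟩ := ringTube_bounds hr1 hsr (by omega) hg hu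
  have hs3 : u ∈ sectorNear 3 ((P.M : ℤ) / 8) := by
    simp only [sectorNear, Set.mem_setOf_eq]; omega
  by_cases hside : ringSide P.rW P.s g = 3
  · rw [hside] at hl1 hl2
    simp only [lat] at hl1 hl2
    have hes : (P.e : ℤ) < P.s := by omega
    have hι : σ.oyLo P ≤ ringLat P.rW P.s g ∧ ringLat P.rW P.s g ≤ σ.oyHi P := by
      constructor
      · have := idx_le_succ_of_le_add (d := (P.e : ℤ)) (ι := σ.oyLo P + 1) (κ := ringLat P.rW P.s g) (r := (P.rW : ℤ))
          (ξ := σ.otgo P) hes (by push_cast; exact hylo) (by linarith)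
        omega
      · have h := idx_le_succ_of_lt (d := (P.e : ℤ)) (κ := ringLat P.rW P.s g) (ι := latIdx P.s P.rW (σ.otgo P + (P.N' / 64 : ℕ)))
          (r := (P.rW : ℤ)) (ξ := σ.otgo P + (P.N' / 64 : ℕ)) hes (by linarith) (by
            have := hyhi; unfold Slot.oyHi at this; rw [Nat.cast_add, Nat.cast_one] at this; exact this)
        unfold Slot.oyHi; exact h
    have hpos := pos_le_of_side_lat hr1 hg
    rw [hside, ← hnWdef] at hpos
    unfold piecePos at hpos
    simp only [show (3 : ℕ) % 3 = 0 from rfl, show (0 : ℕ) ≠ 2 from by decide, if_false] at hpos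
    unfold Slot.oloW Slot.ohiW at hout
    rcases hout with hout | hout <;> omega
  · exact Set.disjoint_left.1 (disjoint_sectorNear (ringSide_lt P.rW P.s g) (by norm_num) hside (by omega)) hsec hs3

/-! ### Assembly -/

namespace Slot

variable {P : OParams} {σ : Slot}

/-- The frames anti-commute with the central symmetry: `-(frameIso ic' u) = frameIso ic u`, `ic' = (ic + 3) % 6` (`ic < 6`). [folklore] -/
theorem neg_frameIso_ic' (hic : σ.ic < 6) (u : Site 2) : -(frameIso σ.ic' u) = frameIso σ.ic u := by
  show -(frameIso ((σ.ic + 3) % 6) u) = frameIso σ.ic u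
  rw [frameIso_add_three hic, neg_neg]

/-- **The private supports of the two colours are disjoint** (valid rung, slot in range, admissible,
separated). [cite: Nolin2008, §4.3 Lemma 13 (arXiv 0711.4948: Lemma 12)] -/
theorem disjoint_oPfin_oMfin (hV : P.Valid) (hσ : σ.OInRange P) (hadm : σ.OAdmissible P) (hsep : σ.OSepOK P) :
    Disjoint (σ.oPfin P) (σ.oMfin P) := by
  obtain ⟨hs, hk₀, hμ, hw1, hw2, he1, he2, hε1, hε2, hrB1, hrB2, hrW1, hrW2, hnB, hnW, hN, hWB, hWW, hn, hμM, hR₀, hR₀M, hLB, hLW⟩ := hV.ifacts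
  have hko1 : (P.k₀ : ℤ) ≤ σ.oko P := by exact_mod_cast le_trapScale P.k₀ σ.jo
  have hkc1 : (P.k₀ : ℤ) ≤ σ.okc P := by exact_mod_cast le_trapScale P.k₀ σ.jc
  have hko2 : 32 * (σ.oko P : ℤ) ≤ P.μ := by exact_mod_cast P.scale_le hσ.hjo
  have hkc2 : 32 * (σ.okc P : ℤ) ≤ P.μ := by exact_mod_cast P.scale_le hσ.hjc
  obtain ⟨ha1, ha2, ha3, ha4⟩ := hadm
  have hic' : σ.ic' < 6 := Nat.mod_lt _ (by norm_num)
  have hξc : σ.oξc P = σ.oTc P + 2 * σ.okc P + P.w := rfl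
  -- norms of the pieces
  have nearB : ∀ v ∈ onearSet σ.io P.M (σ.oko P) (σ.oTo P) P.w P.LB P.ε, 2 * (P.M : ℤ) < triNorm v ∧ triNorm v ≤ 2 * (P.M : ℤ) + 2 * σ.oko P + P.LB :=
    fun v hv => norm_of_mem_onearSet hσ.hio (by omega) (by omega) (by omega) (by omega) (by omega) hv
  have nearW : ∀ v ∈ onearSet σ.ic' P.M (σ.okc P) (σ.oTc P) P.w P.LW P.ε, 2 * (P.M : ℤ) < triNorm v ∧ triNorm v ≤ 2 * (P.M : ℤ) + 2 * σ.okc P + P.LW :=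
    fun v hv => norm_of_mem_onearSet hic' (by omega) (by omega) (by omega) (by omega) (by omega) hv
  have arcB : ∀ v ∈ boxAll (arc (thinRing P.rB P.e P.s) (σ.oaB P) P.lenB), (P.rB : ℤ) - P.s - 2 * P.e ≤ triNorm v ∧ triNorm v ≤ (P.rB : ℤ) + 2 * P.e :=
    fun v hv => norm_of_mem_boxAll_arc (by omega) hv
  have arcW : ∀ v ∈ boxAll (arc (thinRing P.rW P.e P.s) (σ.oaW P) (σ.olenW P)), (P.rW : ℤ) - P.s - 2 * P.e ≤ triNorm v ∧ triNorm v ≤ (P.rW : ℤ) + 2 * P.e :=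
    fun v hv => norm_of_mem_boxAll_arc (by omega) hv
  have farB : ∀ v ∈ ofarSet P.rB P.e (σ.otgo P) P.WB P.N', (P.rB : ℤ) - 2 * P.e ≤ v 0 :=
    fun v hv => apply_zero_of_mem_ofarSet (by omega) hv
  have farW : ∀ v ∈ ofarSet P.rW P.e (σ.otgc P) P.WW P.N', (P.rW : ℤ) - 2 * P.e ≤ v 0 :=
    fun v hv => apply_zero_of_mem_ofarSet (by omega) hv
  have n0 : ∀ v : Site 2, v 0 ≤ triNorm v := fun v => le_triNorm_iff_lin.2 (Or.inl le_rfl)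
  have n0' : ∀ v : Site 2, -v 0 ≤ triNorm v := fun v => le_triNorm_iff_lin.2 (Or.inr (Or.inl le_rfl))
  rw [Finset.disjoint_left]
  intro v hvP hvM
  rw [oPfin, ← Finset.mem_coe, coe_ocorrFin] at hvP
  rw [oMfin, Finset.mem_image] at hvM
  obtain ⟨u, hu, huv⟩ := hvM
  have hvu : u = -v := by rw [← huv, neg_neg]
  subst hvu
  rw [← Finset.mem_coe, coe_ocorrFin] at hu
  rcases hvP with (hvP | hvP) | hvP <;> rcases hu with (hu | hu) | hu
  · -- near / near: the reflected closed near set is the near set of the frame `ic`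
    have hu' : v ∈ onearSet σ.ic P.M (σ.okc P) (σ.oTc P) P.w P.LW P.ε := by
      obtain ⟨x, hx, hxv⟩ := hu
      refine ⟨x, hx, ?_⟩
      rw [← neg_frameIso_ic' hσ.hic, hxv, neg_neg]
    exact onearSet_disjoint_onearSet hσ.hio hσ.hic (by omega) (by omega) (by omega) (by omega) (by omega) (by omega)
      ⟨ha1, ha2, ha3, ha4⟩ (by omega) ⟨by omega, by omega⟩ hsep hvP hu'
  · have h1 := nearB v hvP; have h2 := arcW _ hu; rw [triNorm_neg] at h2
    clear * - h1 h2 hrW1 hLB hko2 hs he1 hμ hk₀; omega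
  · have h1 := nearB v hvP; have h2 := farW _ hu; have h3 := n0' v; simp only [Pi.neg_apply] at h2
    clear * - h1 h2 h3 hrW1 hLB hko2 hs he1 hμ hk₀; omega
  · -- arc B / near W: the white slot frame box is below ring B, the white spoke crosses a window
    obtain ⟨x, hx, hxv⟩ := hu
    have hv' : v = frameIso σ.ic x := by rw [← neg_frameIso_ic' hσ.hic, hxv, neg_neg]
    rcases hx with hx | hx
    · rw [Finset.mem_coe, mem_oslotFrame (by omega)] at hx
      have h1 := arcB v hvP
      have h2 : triNorm v ≤ 2 * (P.M : ℤ) + 5 * σ.okc P := by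
        rw [hv', triNorm_frameIso σ.ic hσ.hic]; exact triNorm_le_iff_lin.2 (by omega)
      clear * - h1 h2 hrB1 hkc2 hs he1 hμ hk₀; omega
    · obtain ⟨hι1, hι2, hnB1, hblo, hhi5, hhiE, hhiR, hsc1, hsc2⟩ := owindowB_facts hV hσ ⟨ha1, ha2, ha3, ha4⟩
      obtain ⟨T, hT, hvT⟩ := hvP
      have hnBdef : P.nB = P.rB / P.s := rfl
      have hsr : P.s ∣ P.rB := ⟨P.nB, by have := hV.facts.2.2.2.2.2.2.2.2.2.2.1; rw [mul_comm]; exact this.symm⟩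
      have hlen : P.lenB = 12 * P.nB - 4 - (σ.ohiB P - σ.oloB P + 1) := by unfold OParams.lenB; omega
      have hr1 : 1 ≤ P.rB / P.s := hnBdef ▸ hnB1
      have hLlen : (thinRing P.rB P.e P.s).length = 12 * P.nB - 4 := by rw [length_thinRing (e := P.e) hr1]; rfl
      rw [show σ.oaB P = σ.ohiB P + 1 from rfl, hlen, ← hLlen] at hT
      obtain ⟨g, hg, hgout, hget⟩ := mem_arc_compl (by omega) (by rw [hLlen]; exact hhiR) hT
      rw [hLlen] at hg
      replace hg : g < 12 * (P.rB / P.s) - 4 := hnBdef ▸ hg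
      rw [getElem?_thinRing hr1 hg] at hget
      have hTg : T = ringTube P.rB P.e P.s g := (Option.some.inj hget).symm
      rw [hTg] at hvT
      refine oringTube_disjoint_ospoke hr1 hsr (by omega) hg hσ.hic (by omega) (by rw [← hnBdef]; omega)
        (by rw [← hnBdef]; unfold Slot.oloB Slot.ohiB at hgout; exact hgout) ⟨hsc1, hsc2⟩ (by omega)
        (lam := (P.R₀ : ℤ) - (2 * σ.okc P + P.w + P.ε)) (by omega) (by omega) (by
          have : 4 * ((σ.okc P / 4 : ℕ) : ℤ) ≤ σ.okc P := by omega
          omega) hvT ⟨x, hx, hv'.symm⟩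
  · have h1 := arcB v hvP; have h2 := arcW _ hu; rw [triNorm_neg] at h2
    clear * - h1 h2 hrB2 hrW1 hs he1 hμ hk₀; omega
  · have h1 := arcB v hvP; have h2 := farW _ hu; have h3 := n0' v; simp only [Pi.neg_apply] at h2
    clear * - h1 h2 h3 hrB2 hrW1 hs he1 hμ hk₀; omega
  · -- far B / near W
    have hu' : v ∈ onearSet σ.ic P.M (σ.okc P) (σ.oTc P) P.w P.LW P.ε := by
      obtain ⟨x, hx, hxv⟩ := hu
      refine ⟨x, hx, ?_⟩
      rw [← neg_frameIso_ic' hσ.hic, hxv, neg_neg]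
    rcases hvP with hvP | hvP
    · exact oapproach_disjoint_onearSet hV hσ ⟨ha1, ha2, ha3, ha4⟩ hvP hu'
    · rw [mem_triStrip] at hvP
      have h1 := n0 v; have h2 := nearW _ hu; rw [triNorm_neg] at h2
      clear * - hvP h1 h2 hN hLW hkc2 hμM hs he1 hμ hk₀; omega
  · -- far B / arc W: the approach tube crosses the window of ring W; the target box is far
    rcases hvP with hvP | hvP
    · obtain ⟨hnW1, hlohi, hhiR, -⟩ := owindowW_facts (σ := σ) hV
      obtain ⟨T, hT, huT⟩ := hu
      have hnWdef : P.nW = P.rW / P.s := rfl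
      have hr1 : 1 ≤ P.rW / P.s := hnWdef ▸ hnW1
      have hLlen : (thinRing P.rW P.e P.s).length = 12 * P.nW - 4 := by rw [length_thinRing (e := P.e) hr1]; rfl
      rw [show σ.oaW P = σ.ohiW P + 1 from rfl, show σ.olenW P = 12 * P.nW - 4 - (σ.ohiW P - σ.oloW P + 1) from rfl, ← hLlen] at hT
      obtain ⟨g, hg, hgout, hget⟩ := mem_arc_compl hlohi (by rw [hLlen]; exact hhiR) hT
      rw [hLlen] at hg
      replace hg : g < 12 * (P.rW / P.s) - 4 := hnWdef ▸ hg
      rw [getElem?_thinRing hr1 hg] at hget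
      have hTg : T = ringTube P.rW P.e P.s g := (Option.some.inj hget).symm
      rw [hTg] at huT
      exact oringTube_disjoint_neg_oapproach hV hg hgout huT (by rw [neg_neg]; exact hvP)
    · rw [mem_triStrip] at hvP
      have h1 := n0 v; have h2 := arcW _ hu; rw [triNorm_neg] at h2
      clear * - hvP h1 h2 hN hrW2 hμM hs he1 hμ hk₀; omega
  · have h1 := farB v hvP; have h2 := farW _ hu; simp only [Pi.neg_apply] at h2
    clear * - h1 h2 hrB1 hrW1 he1 hk₀ hs hμ; omega

/-- **The shared support is disjoint from the private supports** (all private sites lie beyond `Λ_{2M}`). [cite: Nolin2008, §4.3 Lemma 13 (arXiv 0711.4948: Lemma 12)] -/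
theorem disjoint_oshared (hV : P.Valid) (hσ : σ.OInRange P) (hadm : σ.OAdmissible P) :
    Disjoint (osharedFin P.n P.M) (σ.oPfin P) ∧ Disjoint (osharedFin P.n P.M) (σ.oMfin P) := by
  obtain ⟨hs, hk₀, hμ, hw1, hw2, he1, he2, hε1, hε2, hrB1, hrB2, hrW1, hrW2, hnB, hnW, hN, hWB, hWW, hn, hμM, hR₀, hR₀M, hLB, hLW⟩ := hV.ifacts
  have hko1 : (P.k₀ : ℤ) ≤ σ.oko P := by exact_mod_cast le_trapScale P.k₀ σ.jo
  have hkc1 : (P.k₀ : ℤ) ≤ σ.okc P := by exact_mod_cast le_trapScale P.k₀ σ.jc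
  have hko2 : 32 * (σ.oko P : ℤ) ≤ P.μ := by exact_mod_cast P.scale_le hσ.hjo
  have hkc2 : 32 * (σ.okc P : ℤ) ≤ P.μ := by exact_mod_cast P.scale_le hσ.hjc
  obtain ⟨ha1, ha2, ha3, ha4⟩ := hadm
  have hic' : σ.ic' < 6 := Nat.mod_lt _ (by norm_num)
  have n0 : ∀ v : Site 2, v 0 ≤ triNorm v := fun v => le_triNorm_iff_lin.2 (Or.inl le_rfl)
  constructor
  · rw [Finset.disjoint_left]
    intro v hv hv'
    rw [mem_osharedFin] at hv
    rw [← Finset.mem_coe, oPfin, coe_ocorrFin] at hv'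
    rcases hv' with (hv' | hv') | hv'
    · have := norm_of_mem_onearSet hσ.hio (by omega) (by omega) (by omega) (by omega) (by omega) hv'; clear * - hv this; omega
    · have := norm_of_mem_boxAll_arc (by omega) hv'; clear * - hv this hrB1 he1 hμ hk₀ hs; omega
    · have := apply_zero_of_mem_ofarSet (by omega) hv'; have h1 := n0 v; clear * - hv this h1 hrB1 he1 hμ hk₀; omega
  · rw [Finset.disjoint_left]
    intro v hv hv'
    rw [mem_osharedFin] at hv
    rw [oMfin, Finset.mem_image] at hv'
    obtain ⟨u, hu, rfl⟩ := hv'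
    rw [triNorm_neg] at hv
    rw [← Finset.mem_coe, coe_ocorrFin] at hu
    rcases hu with (hu | hu) | hu
    · have := norm_of_mem_onearSet hic' (by omega) (by omega) (by omega) (by omega) (by omega) hu; clear * - hv this; omega
    · have := norm_of_mem_boxAll_arc (by omega) hu; clear * - hv this hrW1 he1 hμ hk₀ hs; omega
    · have := apply_zero_of_mem_ofarSet (by omega) hu; have h1 := n0 u; clear * - hv this h1 hrW1 he1 hμ hk₀; omega

end Slot


/-! ### The move, per slot -/

namespace Slot

variable {P : OParams} {σ : Slot}

/-- **The outer landing move of a slot**: on `oblackArm σ ∩ owhiteArm σ ∩ (oblackCorr σ ∩ owhiteCorr σ)`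
both arms land on `∂Λ_{4M}`: `⊆ extTwoArm n (4M)` (valid rung, slot in range). [cite: Nolin2008, §4.3 Prop. 12 and §4.4 (arXiv 0711.4948: Prop. 11, Thm. 10, p. 12)] -/
theorem omove (hV : P.Valid) (hσ : σ.OInRange P) :
    σ.oblackArm P ∩ σ.owhiteArm P ∩ (σ.oblackCorr P ∩ σ.owhiteCorr P) ⊆ extTwoArm P.n (4 * P.M) := by
  rintro ω ⟨⟨hbA, hwA⟩, hbC, hwC⟩
  have hadm : σ.OAdmissible P := oadmissible_of_mem ⟨hbA, hwA⟩
  have hsep : σ.OSepOK P := osepOK_of_mem hV ⟨hbA, hwA⟩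
  obtain ⟨hs, hw, he, hε, hk₀, hμ, hrB1, hrB2, hrW1, hrW2, hnB, hnW, hN, hWB, hWW, hn, hμM, hR₀, hR₀M, hLB, hLW⟩ := hV.facts
  obtain ⟨hsI, hk₀I, hμI, hw1, hw2, he1, he2, hε1, hε2, hrB1I, hrB2I, hrW1I, hrW2I, hnBI, hnWI, hNI, hWBI, hWWI, hnI, hμMI, hR₀I, hR₀MI, hLBI, hLWI⟩ := hV.ifacts
  have hnB1 := hV.one_le_nB
  have hnW1 := hV.one_le_nW
  have hic' : σ.ic' < 6 := Nat.mod_lt _ (by norm_num)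
  obtain ⟨hξo0, hξc0, hξo1, hξc1⟩ := oξ_bounds hV hσ hadm
  have hsrB : P.s ∣ P.rB := ⟨P.nB, by rw [mul_comm]; exact hnB.symm⟩
  have hsrW : P.s ∣ P.rW := ⟨P.nW, by rw [mul_comm]; exact hnW.symm⟩
  constructor
  · -- the open arm
    obtain ⟨Fo, hmid, hj, h1, h2⟩ := hbA
    obtain ⟨⟨⟨⟨hB, hSp⟩, harc⟩, hH⟩, hVt⟩ := hbC
    have hko : Fo.k = σ.oko P := by show trapScale P.k₀ Fo.j = trapScale P.k₀ σ.jo; rw [hj]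
    have hko1 : P.k₀ ≤ σ.oko P := le_trapScale _ _
    have hko2 : 32 * σ.oko P ≤ P.μ := P.scale_le hσ.hjo
    have hιo : latIdx P.s P.rB (σ.oξo P) < P.nB := latIdx_lt hnB1 hnB hξo0
    have hso := latIdx_spec (r := P.rB) (s := P.s) (by omega) (show -(P.rB : ℤ) ≤ σ.oξo P by omega)
    obtain ⟨hxd, hlo, hhi, -, -⟩ := orunB_facts (σ := σ) hV
    have hJ : SpokeMeets σ.io (ospokeTube P.M Fo.k (σ.oTo P) P.w P.LB P.ε)
        (pieceTube P.rB P.e P.s P.nB σ.io (latIdx P.s P.rB (σ.oξo P))) := by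
      rw [hko]
      refine ospokeMeets_pieceTube hσ.hio hnB hιo hso (by omega) ?_ ?_
      · omega
      · omega
    refine out_landing_move (R₀ := P.R₀) hV.hn hσ.hio Fo hmid (by rw [hko]; omega) (T₀ := σ.oTo P) (w := P.w)
      (by rw [hko]; omega) (by rw [hko]; omega) ⟨h1, h2⟩ (by rw [hko]; exact hB) (L := P.LB) (ε := P.ε)
      (by rw [hko]; omega) (by rw [hko]; omega) (by rw [hko]; exact hSp) (r := P.rB) (e := P.e) (s := P.s) (a := σ.oaB P) (len := P.lenB)
      (by omega) hsrB (by omega) (by omega) harc (ogEo_mem_arc hV hσ hadm hsep) hJ (b := σ.obo P) (j₀ := σ.oxo P) (d := P.d)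
      (orunB_mem_arc hV hσ hadm) hlo hhi (W := P.WB) hWBI hH hVt (by omega) (by rw [hko]; omega) (by omega) (by omega)
  · -- the closed arm
    obtain ⟨Fc, hmid, hj, h1, h2⟩ := hwA
    obtain ⟨⟨⟨⟨hB, hSp⟩, harc⟩, hH⟩, hVt⟩ := hwC
    have hkc : Fc.k = σ.okc P := by show trapScale P.k₀ Fc.j = trapScale P.k₀ σ.jc; rw [hj]
    have hkc1 : P.k₀ ≤ σ.okc P := le_trapScale _ _
    have hkc2 : 32 * σ.okc P ≤ P.μ := P.scale_le hσ.hjc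
    have hιc : latIdx P.s P.rW (σ.oξc P) < P.nW := latIdx_lt hnW1 hnW hξc0
    have hsc := latIdx_spec (r := P.rW) (s := P.s) (by omega) (show -(P.rW : ℤ) ≤ σ.oξc P by omega)
    obtain ⟨-, -, -, -, -, -, -, -, -, -, -, hxd, hlo, hhi⟩ := owindowW_facts (σ := σ) hV
    have hJ : SpokeMeets σ.ic' (ospokeTube P.M Fc.k (σ.oTc P) P.w P.LW P.ε)
        (pieceTube P.rW P.e P.s P.nW σ.ic' (latIdx P.s P.rW (σ.oξc P))) := by
      rw [hkc]
      refine ospokeMeets_pieceTube hic' hnW hιc hsc (by omega) ?_ ?_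
      · omega
      · omega
    exact out_white_landing_move (R₀ := P.R₀) hV.hn hσ.hic Fc hmid (by rw [hkc]; omega) (T₀ := σ.oTc P) (w := P.w)
      (by rw [hkc]; omega) (by rw [hkc]; omega) ⟨h1, h2⟩ (by rw [hkc]; exact hB) (L := P.LW) (ε := P.ε)
      (by rw [hkc]; omega) (by rw [hkc]; omega) (by rw [hkc]; exact hSp) (r := P.rW) (e := P.e) (s := P.s) (a := σ.oaW P) (len := σ.olenW P)
      (by omega) hsrW (by omega) (by omega) harc (ogEc_mem_arc hV hσ hadm) hJ (b := σ.obc P) (j₀ := σ.oxc P) (d := P.d)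
      (orunW_mem_arc hV) hlo hhi (W := P.WW) hWWI hH hVt (by omega) (by rw [hkc]; omega) (by omega) (by omega)

/-! ### Nolin's Lemma 13, per slot -/

/-- **The tiny-fenced pair of a slot lands at bounded cost** (Nolin 2008, Prop. 12 (i)/(iii) via
Lemma 13): for a valid rung and a slot in range,
`P(oblackArm ∩ owhiteArm) · (c_F c^(12 nW + 3))² ≤ P(extTwoArm n (4M))`, where `c_F` is the frame
constant and `c` the RSW constant at an aspect ratio `ρ ≥ 64` with `LW + μ ≤ 2ρε`: the generalised
FKG inequality with the shared support `osharedFin n M` and the private supports `oPfin`, `oMfin`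
(pairwise disjoint by `disjoint_oPfin_oMfin`, `disjoint_oshared`), the corridor probabilities
(`real_ocorr_ge`) and the move (`omove`). [cite: Nolin2008, §4.3 Prop. 12 and Lemma 13 (arXiv 0711.4948: Prop. 11, Lemma 12); §4.4 p. 12 (constants C₁, C₂)] -/
theorem real_oarms_le (hV : P.Valid) (hσ : σ.OInRange P) {cF c : ℝ} {ρ : ℕ}
    (hF : ∀ (z : Site 2) (k : ℕ), 1 ≤ k → cF ≤ (triSitePercolation half).real (triFrameAt z k))
    (hrsw : ∀ q : ℕ, 1 ≤ ⌊(ρ : ℝ) * q⌋₊ → c ≤ triLRCrossingProb half ⌊(ρ : ℝ) * q⌋₊ q) (hc : 0 ≤ c) (hcF : 0 ≤ cF)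
    (hρ : 64 ≤ ρ) (hρsp : P.LW + P.μ ≤ ρ * (2 * P.ε)) :
    (triSitePercolation half).real (σ.oblackArm P ∩ σ.owhiteArm P) * (cF * c ^ (12 * P.nW + 3)) ^ 2 ≤
      (triSitePercolation half).real (extTwoArm P.n (4 * P.M)) := by
  classical
  by_cases hne : (σ.oblackArm P ∩ σ.owhiteArm P).Nonempty
  swap
  · rw [Set.not_nonempty_iff_eq_empty.1 hne, measureReal_empty, zero_mul]; exact measureReal_nonneg
  obtain ⟨ω₀, hω₀⟩ := hne
  have hadm : σ.OAdmissible P := oadmissible_of_mem hω₀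
  have hsep : σ.OSepOK P := osepOK_of_mem hV hω₀
  have hk2 : 2 ≤ P.k₀ := le_trans (by norm_num) hV.hk₀
  -- the three pairwise disjoint regions of Nolin's Lemma 13
  obtain ⟨hSP, hSM⟩ := disjoint_oshared hV hσ hadm
  have hPM := disjoint_oPfin_oMfin hV hσ hadm hsep
  -- supports of the arm events
  have dAp : DeterminedBy (σ.oblackArm P) (↑(osharedFin P.n P.M) ∪ ↑(σ.oPfin P)) := by
    refine (determinedBy_oblackArm P σ hV hσ.hio).mono (Set.union_subset_union_right _ ?_)
    intro v hv
    rw [oPfin, coe_ocorrFin]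
    exact Or.inl (Or.inl (by obtain ⟨u, hu, rfl⟩ := hv; exact ⟨u, Or.inl hu, rfl⟩))
  have dAm : DeterminedBy (σ.owhiteArm P) (↑(osharedFin P.n P.M) ∪ ↑(σ.oMfin P)) := by
    refine (determinedBy_owhiteArm P σ hV hσ.hic).mono (Set.union_subset_union_right _ ?_)
    intro v hv
    obtain ⟨u, hu, rfl⟩ := hv
    rw [oMfin, Finset.coe_image, coe_ocorrFin]
    refine ⟨frameIso σ.ic' u, Or.inl (Or.inl ⟨u, Or.inl hu, rfl⟩), ?_⟩
    exact neg_frameIso_ic' hσ.hic u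
  have fkg := triSitePercolation_locallyMonotone_fkg half hSP hSM hPM
    (Ap := σ.oblackArm P) (Am := σ.owhiteArm P) (Bp := σ.oblackCorr P) (Bm := σ.owhiteCorr P)
    (isUpperSet_oblackArm P σ) (isLowerSet_owhiteArm P σ) (isUpperSet_oblackCorr P σ) (isLowerSet_owhiteCorr P σ)
    dAp dAm (determinedBy_oblackCorr P σ hk2) (determinedBy_owhiteCorr P σ hk2)
  obtain ⟨hB, hW⟩ := real_ocorr_ge (σ := σ) hV hσ hF hrsw hc hρ hρsp
  have hq : 0 ≤ cF * c ^ (12 * P.nW + 3) := by positivity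
  calc (triSitePercolation half).real (σ.oblackArm P ∩ σ.owhiteArm P) * (cF * c ^ (12 * P.nW + 3)) ^ 2
      ≤ (triSitePercolation half).real (σ.oblackArm P ∩ σ.owhiteArm P) *
          ((triSitePercolation half).real (σ.oblackCorr P) * (triSitePercolation half).real (σ.owhiteCorr P)) := by
        rw [sq]
        exact mul_le_mul_of_nonneg_left (mul_le_mul hB hW hq measureReal_nonneg) measureReal_nonneg
    _ ≤ (triSitePercolation half).real (σ.oblackArm P ∩ σ.owhiteArm P ∩ (σ.oblackCorr P ∩ σ.owhiteCorr P)) := fkg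
    _ ≤ (triSitePercolation half).real (extTwoArm P.n (4 * P.M)) := measureReal_mono (omove hV hσ)

end Slot

/-! ### The sum over slots -/

/-- **A pair of tiny-fenced outer arms with middle tips** (the output of the outer separation step,
Nolin's `Ã^{·/η'}(n, 2M)` "the arms can be made well-separated on `∂S_{2M}`", with the corner
margin `R₀`): in some frame `io < 6` a fenced open outer arm of `frameConfig io ω`, and in some frame
`ic < 6` a fenced closed outer arm (an open arm of `(frameConfig ic ω)ᶜ`), both with tips at height
`-2M + R₀ ≤ z₁ ≤ -R₀`. [cite: Nolin2008, §4.4 (arXiv 0711.4948: proof of Thm. 10, p. 12)] -/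
def OutMidPair (P : OParams) : Set (SiteConfig (Site 2)) :=
  {ω | ∃ io < 6, ∃ ic < 6,
    (∃ Fo : TrapFencedArm P.M P.n P.k₀ P.K (frameConfig io ω), -(2 * (P.M : ℤ)) + P.R₀ ≤ Fo.z 1 ∧ Fo.z 1 ≤ -(P.R₀ : ℤ)) ∧
    ∃ Fc : TrapFencedArm P.M P.n P.k₀ P.K (frameConfig ic ω)ᶜ, -(2 * (P.M : ℤ)) + P.R₀ ≤ Fc.z 1 ∧ Fc.z 1 ≤ -(P.R₀ : ℤ)}

/-- **The finite set of slot index tuples** of a rung: sides `< 6`, scale indices `< K`, window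
indices `< Nw` for the two tips. [folklore] -/
def otupleFin (P : OParams) : Finset ((((((ℕ × ℕ) × ℕ) × ℕ) × ℕ) × ℕ)) :=
  (((((Finset.range 6) ×ˢ (Finset.range P.K)) ×ˢ (Finset.range P.Nw)) ×ˢ (Finset.range 6)) ×ˢ (Finset.range P.K)) ×ˢ
    (Finset.range P.Nw)

/-- The slot of an index tuple. [folklore] -/
def slotOf (t : (((((ℕ × ℕ) × ℕ) × ℕ) × ℕ) × ℕ)) : Slot := ⟨t.1.1.1.1.1, t.1.1.1.1.2, t.1.1.1.2, t.1.1.2, t.1.2, t.2⟩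

/-- Slots of tuples of `otupleFin` are in range. [folklore] -/
theorem oinRange_slotOf {P : OParams} {t : (((((ℕ × ℕ) × ℕ) × ℕ) × ℕ) × ℕ)} (h : t ∈ otupleFin P) : (slotOf t).OInRange P := by
  simp only [otupleFin, Finset.mem_product, Finset.mem_range] at h
  exact ⟨h.1.1.1.1.1, h.1.1.1.1.2, h.1.1.2, h.1.2⟩

/-- The number of index tuples is `36 K² Nw²`. [folklore] -/
theorem card_otupleFin (P : OParams) : (otupleFin P).card = 36 * P.K ^ 2 * P.Nw ^ 2 := by
  simp only [otupleFin, Finset.card_product, Finset.card_range]; ring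

/-- **The slots cover the pairs**: `OutMidPair P ⊆ ⋃_{t ∈ otupleFin P} (oblackArm (slotOf t) ∩ owhiteArm (slotOf t))`
(`1 ≤ w`, `1 ≤ R₀`). [cite: Nolin2008, §4.4 (arXiv 0711.4948: Thm. 10, external extremities)] -/
theorem outMidPair_subset_biUnion (P : OParams) (hw : 1 ≤ P.w) (hR : 1 ≤ P.R₀) :
    OutMidPair P ⊆ ⋃ t ∈ otupleFin P, Slot.oblackArm P (slotOf t) ∩ Slot.owhiteArm P (slotOf t) := by
  intro ω hω
  obtain ⟨io, hio, ic, hic, ⟨Fo, hFo⟩, ⟨Fc, hFc⟩⟩ := hω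
  have h := subset_iUnion_oslot P hw hR hio hic Fo hFo Fc hFc
  simp only [Set.mem_iUnion, Set.mem_setOf_eq, exists_prop] at h
  obtain ⟨σ, hσ, hmem⟩ := h
  simp only [Set.mem_iUnion, exists_prop]
  refine ⟨(((((σ.io, σ.jo), σ.no), σ.ic), σ.jc), σ.nc), ?_, ?_⟩
  · simp only [otupleFin, Finset.mem_product, Finset.mem_range]; tauto
  · exact hmem

/-- **The outer landing inequality** (Nolin 2008, §4.4, p. 12: the constants `C₁(η') C₂(η')` of
the external extremities): for a valid outer rung,
`P(OutMidPair P) · (c_F c^(12 nW + 3))² ≤ 36 K² Nw² · P(extTwoArm n (4M))`. [cite: Nolin2008, §4.4 (arXiv 0711.4948: proof of Thm. 10, p. 12) with §4.3 Prop. 12, Lemma 13] -/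
theorem real_outMidPair_le {P : OParams} (hV : P.Valid) {cF c : ℝ} {ρ : ℕ}
    (hF : ∀ (z : Site 2) (k : ℕ), 1 ≤ k → cF ≤ (triSitePercolation half).real (triFrameAt z k))
    (hrsw : ∀ q : ℕ, 1 ≤ ⌊(ρ : ℝ) * q⌋₊ → c ≤ triLRCrossingProb half ⌊(ρ : ℝ) * q⌋₊ q) (hc : 0 ≤ c) (hcF : 0 ≤ cF)
    (hρ : 64 ≤ ρ) (hρsp : P.LW + P.μ ≤ ρ * (2 * P.ε)) :
    (triSitePercolation half).real (OutMidPair P) * (cF * c ^ (12 * P.nW + 3)) ^ 2 ≤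
      (36 * P.K ^ 2 * P.Nw ^ 2 : ℕ) * (triSitePercolation half).real (extTwoArm P.n (4 * P.M)) := by
  classical
  obtain ⟨hs, hw, he, hε, hk₀, -⟩ := hV.facts
  have hw1 : 1 ≤ P.w := by rw [hw]; omega
  have hR1 : 1 ≤ P.R₀ := by have := hV.hR₀; have := hV.facts.2.2.2.2.2.1; omega
  set q := (cF * c ^ (12 * P.nW + 3)) ^ 2 with hq
  set E := (triSitePercolation half).real (extTwoArm P.n (4 * P.M)) with hE
  have hq0 : 0 ≤ q := by positivity
  have hslot : ∀ t ∈ otupleFin P, (triSitePercolation half).real (Slot.oblackArm P (slotOf t) ∩ Slot.owhiteArm P (slotOf t)) * q ≤ E :=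
    fun t ht => Slot.real_oarms_le hV (oinRange_slotOf ht) hF hrsw hc hcF hρ hρsp
  calc (triSitePercolation half).real (OutMidPair P) * q
      ≤ (triSitePercolation half).real (⋃ t ∈ otupleFin P, Slot.oblackArm P (slotOf t) ∩ Slot.owhiteArm P (slotOf t)) * q :=
        mul_le_mul_of_nonneg_right (measureReal_mono (outMidPair_subset_biUnion P hw1 hR1) (measure_ne_top _ _)) hq0
    _ ≤ (∑ t ∈ otupleFin P, (triSitePercolation half).real (Slot.oblackArm P (slotOf t) ∩ Slot.owhiteArm P (slotOf t))) * q :=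
        mul_le_mul_of_nonneg_right (measureReal_biUnion_finset_le _ _) hq0
    _ = ∑ t ∈ otupleFin P, (triSitePercolation half).real (Slot.oblackArm P (slotOf t) ∩ Slot.owhiteArm P (slotOf t)) * q :=
        Finset.sum_mul _ _ _
    _ ≤ ∑ _t ∈ otupleFin P, E := Finset.sum_le_sum hslot
    _ = (otupleFin P).card * E := by rw [Finset.sum_const, nsmul_eq_mul]
    _ = (36 * P.K ^ 2 * P.Nw ^ 2 : ℕ) * E := by rw [card_otupleFin]

end Literature.Probability.Percolation
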